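import Summits.QuantumFields.BalabanUV.Beta.TentQuasiReconstructionLaplacian
import Summits.QuantumFields.BalabanUV.Beta.TentQuasiReconstructionForms
import Summits.QuantumFields.BalabanUV.Beta.CoarseCoerciveQuasiReconstruction

/-!
# Beta / TentQuasiReconstructionTorus — E-I3 AT U = 1 IN MODEL CURRENCY (the row-D4 owner's OFFER journal l.14232 ∕ NOTE-I3
# §3 (b2)): on the torus (ℤ/m × Fin n)^ν (m ≥ 3 blocks of side n per axis), A = μ·1 + Σ_i D_iᴴD_i (free Laplacian + mass),
# Q̃ = the block MEANS, the tensor TENTS r_y = ⊗_i(1-D trapezoid, ramp width w) are a quasi-reconstruction in the sense of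
# an4's `CoarseCoerciveQuasiReconstruction` (mass matrix: diagonal 1, off-diagonal row∕column sums ≤ (1 + 2w/n)^ν − 1;
# energy ≤ E‖B‖², E = μ3^ν(n+2w)^ν + ν(6/w)3^{ν−1}(6n/w)(n+2w)^{ν−1}); HENCE **Re B*(Q̃A⁻¹Q̃ᵀ)B ≥ (c²/E)‖B‖²,
# c = 2 − (1 + 2w/n)^ν** — B6 (2.76)'s «γ₀ absolute» at U = 1 WITHOUT Fourier analysis (at μ = a/n², w ≍ n/ν:
# γ₀(ν,a)·n^{2−ν}, uniform in n after scaling) (unit `b2b-balaban-beta-d4-p2`, GEN 5, MODEL crew; claim «E-I3-U1-TENSOR» l.14472)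

HONEST FRAMING: discharging `BetaPertH` makes Bałaban's UV stability UNCONDITIONAL — NOT the continuum limit, NOT the
Clay problem.  HONEST DEPENDENCY (verbatim): «continuum YM on T⁴ ⇐ BetaPertH ∧ nine spine estimates (0/9 proved);
BetaPertH ⇐ (D1) ∧ (D4) ∧ CAP+tail; G-an2-4 gates asym, D1 and NE2/3/4.»  THIS MODULE DISCHARGES NOTHING of `BetaPertH`,
asserts NOTHING printed and cites nothing as a fact (ABSOLUTE RULE): [folklore] about a MODEL (free lattice Laplacian, cubic
blocks, U = 1); nothing of Bałaban's operators instantiated; SHAPE located at [B6] = `Balaban1984PropagatorsII` (2.76) p. 236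
and [B9] (3.132) p. 422.  No class change on row D4 or G-B9-15 (width 0; D4 DISCHARGE NO DATE); NOT BetaPertH, NOT continuum,
NOT Clay.  CONTENT: §1 tensor tents∕block means and their sums; §2 `lapA` (Hermitian, form = μ‖g‖² + Σ‖D_ig‖², a unit);
§3 `energy_le`, `mass_entry`∕`mass_diag`∕`mass_row_le`∕`mass_col_le`∕`mass_coercive`; §4 END **`coarse_coercive_tent_torus`**.
-/

namespace Summit.QuantumFields.BalabanUV.Beta.TentQuasiReconstructionTorus

open Finset Matrix
open scoped BigOperators ComplexConjugate
open Summit.QuantumFields.BalabanUV.Beta.TentQuasiReconstruction1D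
open Summit.QuantumFields.BalabanUV.Beta.TentQuasiReconstructionForms
open Summit.QuantumFields.BalabanUV.Beta.TentQuasiReconstructionLaplacian
open Summit.QuantumFields.BalabanUV.Beta.AccretiveCombesThomasSandwich (sandwich)
open Summit.QuantumFields.BalabanUV.Beta.UnitLatticeResolventWalk (Qm superpose)
open Summit.QuantumFields.BalabanUV.Beta.CoarseCoerciveQuasiReconstruction (sandwich_coercive_of_quasiReconstruction
  massMatrix star_superpose_dotProduct_eq)
open Literature.MathematicalPhysics.QuantumFieldTheory.Balaban1983to89.B5Prop11Lower (nsq nsq_nonneg star_dotProduct_self)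

noncomputable section

variable {ν m n : ℕ} [NeZero m]

/-! ## §1  Tensor tents and block means; sums -/

/-- **The tensor tent** of block y: Π_i tent (y i) (x i). [folklore] -/
def tentT (n w : ℕ) (y : Blk ν m) (x : Site ν m n) : ℝ := ∏ i, tent n w (y i) (x i)

/-- **The block mean row** of block y: Π_i ind (y i) (x i) / n. [folklore] -/
def meanT (n : ℕ) (y : Blk ν m) (x : Site ν m n) : ℝ := ∏ i, (ind n (y i) (x i) / n)

/-- The tent as a complex family (the quasi-reconstruction `r`). [folklore] -/
def rT (n w : ℕ) (y : Blk ν m) (x : Site ν m n) : ℂ := ((tentT n w y x : ℝ) : ℂ)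

/-- The block means as a complex family (the rows `q` of Q̃). [folklore] -/
def qT (n : ℕ) (y : Blk ν m) (x : Site ν m n) : ℂ := ((meanT n y x : ℝ) : ℂ)

omit [NeZero m] in
/-- `tentT ≥ 0`. [folklore] -/
theorem tentT_nonneg (w : ℕ) (y : Blk ν m) (x : Site ν m n) : 0 ≤ tentT n w y x :=
  Finset.prod_nonneg fun _ _ => tent_nonneg w _ _

omit [NeZero m] in
/-- **Sum–product exchange**: `Σ_{x : Fin ν → X₁} Π_i g i (x i) = Π_i Σ_a g i a`. [folklore] -/
theorem sum_prod_eq_prod_sum {X₁ : Type} [Fintype X₁] [DecidableEq X₁] (g : Fin ν → X₁ → ℝ) :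
    ∑ x : Fin ν → X₁, ∏ i, g i (x i) = ∏ i, ∑ a, g i a := by
  rw [Finset.prod_univ_sum (fun _ => (Finset.univ : Finset X₁)) g, Fintype.piFinset_univ]

omit [NeZero m] in
/-- The tent at an updated site: `tentT y (update x i s) = tent (y i) s · Π_{k ≠ i} tent (y k) (x k)`. [folklore] -/
theorem tentT_update (w : ℕ) (y : Blk ν m) (x : Site ν m n) (i : Fin ν) (s : ZMod m × Fin n) :
    tentT n w y (Function.update x i s) = tent n w (y i) s * ∏ k ∈ univ.erase i, tent n w (y k) (x k) := by
  unfold tentT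
  have h : (fun k => tent n w (y k) (Function.update x i s k)) =
      Function.update (fun k => tent n w (y k) (x k)) i (tent n w (y i) s) := by
    funext k
    by_cases hk : k = i
    · subst hk; simp
    · rw [Function.update_of_ne hk, Function.update_of_ne hk]
  rw [h, Finset.prod_update_of_mem (Finset.mem_univ i), Finset.sdiff_singleton_eq_erase]

omit [NeZero m] in
/-- The tent split at coordinate i: `tentT y x = tent (y i) (x i) · Π_{k ≠ i} tent (y k) (x k)`. [folklore] -/
theorem tentT_split (w : ℕ) (y : Blk ν m) (x : Site ν m n) (i : Fin ν) :
    tentT n w y x = tent n w (y i) (x i) * ∏ k ∈ univ.erase i, tent n w (y k) (x k) := by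
  unfold tentT
  exact (Finset.mul_prod_erase univ (fun k => tent n w (y k) (x k)) (Finset.mem_univ i)).symm

/-- MODEL bookkeeping: the edge difference of the tensor tent along axis i. [folklore] -/
def dtentT (n w : ℕ) (i : Fin ν) (y : Blk ν m) (x : Site ν m n) : ℝ :=
  tentT n w y (Function.update x i (succ (x i))) - tentT n w y x

omit [NeZero m] in
/-- The edge difference factorises: `dtentT i y x = (tent (y i) (succ (x i)) − tent (y i) (x i)) · Π_{k ≠ i} tent (y k) (x k)`.
[folklore] -/
theorem dtentT_eq (w : ℕ) (i : Fin ν) (y : Blk ν m) (x : Site ν m n) :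
    dtentT n w i y x = (tent n w (y i) (succ (x i)) - tent n w (y i) (x i)) * ∏ k ∈ univ.erase i, tent n w (y k) (x k) := by
  rw [dtentT, tentT_update, tentT_split w y x i]; ring

/-- MODEL bookkeeping: the majorant of the edge difference as a full product over the axes. [folklore] -/
def edgeFac (n w : ℕ) (i : Fin ν) (x : Site ν m n) (k : Fin ν) (b : ZMod m) : ℝ :=
  if k = i then |tent n w b (succ (x k)) - tent n w b (x k)| else tent n w b (x k)

omit [NeZero m] in
/-- `|dtentT i y x| = Π_k edgeFac i x k (y k)`. [folklore] -/
theorem abs_dtentT_eq (w : ℕ) (i : Fin ν) (y : Blk ν m) (x : Site ν m n) :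
    |dtentT n w i y x| = ∏ k, edgeFac n w i x k (y k) := by
  rw [dtentT_eq, abs_mul, abs_of_nonneg (Finset.prod_nonneg fun k _ => tent_nonneg w _ _),
    ← Finset.mul_prod_erase univ (fun k => edgeFac n w i x k (y k)) (Finset.mem_univ i)]
  congr 1
  · simp [edgeFac]
  · exact Finset.prod_congr rfl fun k hk => by rw [edgeFac, if_neg (Finset.ne_of_mem_erase hk)]

omit [NeZero m] in
/-- The same product, read with the BLOCK label fixed and the site varying. [folklore] -/
theorem abs_dtentT_eq' (w : ℕ) (i : Fin ν) (y : Blk ν m) (x : Site ν m n) :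
    |dtentT n w i y x| =
      ∏ k, (if k = i then |tent n w (y k) (succ (x k)) - tent n w (y k) (x k)| else tent n w (y k) (x k)) := by
  rw [dtentT_eq, abs_mul, abs_of_nonneg (Finset.prod_nonneg fun k _ => tent_nonneg w _ _),
    ← Finset.mul_prod_erase univ
      (fun k => if k = i then |tent n w (y k) (succ (x k)) - tent n w (y k) (x k)| else tent n w (y k) (x k))
      (Finset.mem_univ i)]
  congr 1
  · simp
  · exact Finset.prod_congr rfl fun k hk => by rw [if_neg (Finset.ne_of_mem_erase hk)]

omit [NeZero m] in
/-- A product of nonnegative factors bounded by `if k = i then c else d` is ≤ `c·d^{ν−1}`. [folklore] -/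
theorem prod_ite_le {f : Fin ν → ℝ} (i : Fin ν) {c d : ℝ} (hf0 : ∀ k, 0 ≤ f k) (hi : f i ≤ c)
    (hk : ∀ k, k ≠ i → f k ≤ d) : ∏ k, f k ≤ c * d ^ (ν - 1) := by
  rw [← Finset.mul_prod_erase univ f (Finset.mem_univ i)]
  have h1 : ∏ k ∈ univ.erase i, f k ≤ ∏ _k ∈ univ.erase i, d :=
    Finset.prod_le_prod (fun k _ => hf0 k) fun k hk' => hk k (Finset.ne_of_mem_erase hk')
  rw [Finset.prod_const, Finset.card_erase_of_mem (Finset.mem_univ i), Finset.card_univ, Fintype.card_fin] at h1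
  exact mul_le_mul hi h1 (Finset.prod_nonneg fun k _ => hf0 k) ((hf0 i).trans hi)

/-- **At most 3^ν tents see a site**: `Σ_y tentT y x ≤ 3^ν`. [folklore] -/
theorem sum_tentT_at_le (w : ℕ) (x : Site ν m n) : ∑ y : Blk ν m, tentT n w y x ≤ (3 : ℝ) ^ ν := by
  unfold tentT
  rw [sum_prod_eq_prod_sum (fun i b => tent n w b (x i))]
  calc ∏ i, ∑ b : ZMod m, tent n w b (x i) ≤ ∏ _i : Fin ν, (3 : ℝ) :=
        Finset.prod_le_prod (fun i _ => Finset.sum_nonneg fun b _ => tent_nonneg w _ _) fun i _ => sum_tents_at_le w (x i)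
    _ = 3 ^ ν := by rw [Finset.prod_const, Finset.card_univ, Fintype.card_fin]

/-- **The mass of a tensor tent is ≤ (n + 2w)^ν.** [folklore] -/
theorem sum_tentT_le (hm : 3 ≤ m) {w : ℕ} (hw : 1 ≤ w) (y : Blk ν m) :
    ∑ x : Site ν m n, tentT n w y x ≤ ((n : ℝ) + 2 * w) ^ ν := by
  unfold tentT
  rw [sum_prod_eq_prod_sum (fun i a => tent n w (y i) a)]
  calc ∏ i, ∑ a : ZMod m × Fin n, tent n w (y i) a ≤ ∏ _i : Fin ν, ((n : ℝ) + 2 * w) :=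
        Finset.prod_le_prod (fun i _ => Finset.sum_nonneg fun a _ => tent_nonneg w _ _) fun i _ => sum_tent_le hm hw (y i)
    _ = ((n : ℝ) + 2 * w) ^ ν := by rw [Finset.prod_const, Finset.card_univ, Fintype.card_fin]

/-- **The edge differences at a site sum to ≤ (6/w)·3^{ν−1} over the blocks.** [folklore] -/
theorem sum_abs_dtentT_at_le (hm : 3 ≤ m) {w : ℕ} (hw : 1 ≤ w) (hwn : w ≤ n) (i : Fin ν) (x : Site ν m n) :
    ∑ y : Blk ν m, |dtentT n w i y x| ≤ 6 / w * (3 : ℝ) ^ (ν - 1) := by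
  simp only [abs_dtentT_eq]
  rw [sum_prod_eq_prod_sum (fun k b => edgeFac n w i x k b)]
  refine prod_ite_le i (fun k => Finset.sum_nonneg fun b _ => ?_) ?_ ?_
  · unfold edgeFac; split_ifs; exacts [abs_nonneg _, tent_nonneg w _ _]
  · simp only [edgeFac, if_true]; exact sum_abs_tdiff_at_le hm hw hwn (x i)
  · intro k hk; simp only [edgeFac, if_neg hk]; exact sum_tents_at_le w (x k)

/-- **The edge differences of one tent sum to ≤ (6n/w)·(n + 2w)^{ν−1} over the sites.** [folklore] -/
theorem sum_abs_dtentT_le [NeZero n] (hm : 3 ≤ m) {w : ℕ} (hw : 1 ≤ w) (hwn : w ≤ n) (i : Fin ν) (y : Blk ν m) :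
    ∑ x : Site ν m n, |dtentT n w i y x| ≤ 6 * n / w * ((n : ℝ) + 2 * w) ^ (ν - 1) := by
  simp only [abs_dtentT_eq']
  rw [sum_prod_eq_prod_sum
    (fun k a => if k = i then |tent n w (y k) (succ a) - tent n w (y k) a| else tent n w (y k) a)]
  refine prod_ite_le i (fun k => Finset.sum_nonneg fun a _ => ?_) ?_ ?_
  · split_ifs; exacts [abs_nonneg _, tent_nonneg w _ _]
  · simp only [if_true]; exact sum_abs_tdiff_le hm hw hwn (y i)
  · intro k hk; simp only [if_neg hk]; exact sum_tent_le hm hw (y k)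

/-! ## §3  Energy and mass of the tensor tents -/

omit [NeZero m] in
/-- Unfolding of `superpose`: `(superpose q z)(x) = Σ_y q y x · z y`. [folklore] -/
theorem superpose_apply {X Y : Type*} [Fintype Y] (q : Y → X → ℂ) (z : Y → ℂ) (x : X) :
    superpose q z x = ∑ y, q y x * z y := by
  simp [superpose, Qm, Matrix.mulVec, dotProduct, Matrix.conjTranspose_apply]

/-- `D_i` of the superposition of tents is the superposition of the edge differences. [folklore] -/
theorem dMat_superpose (w : ℕ) (i : Fin ν) (B : Blk ν m → ℂ) (x : Site ν m n) :
    (dMat i *ᵥ superpose (rT n w) B) x = ∑ y, ((dtentT n w i y x : ℝ) : ℂ) * B y := by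
  rw [dMat_mulVec, superpose_apply, superpose_apply, ← Finset.sum_sub_distrib]
  refine Finset.sum_congr rfl fun y _ => ?_
  rw [dtentT, rT, rT, Complex.ofReal_sub, sub_mul]

/-- MODEL bookkeeping: **the energy constant** E = μ·3^ν(n + 2w)^ν + ν·((6/w)3^{ν−1})·((6n/w)(n + 2w)^{ν−1}). [folklore] -/
def energyConst (ν n w : ℕ) (μ : ℝ) : ℝ :=
  μ * (3 : ℝ) ^ ν * ((n : ℝ) + 2 * w) ^ ν + ν * (6 / w * (3 : ℝ) ^ (ν - 1)) * (6 * n / w * ((n : ℝ) + 2 * w) ^ (ν - 1))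

/-- **ENERGY**: `Re (SB)*A(SB) ≤ E‖B‖²` for the superposition `SB = Σ_y B_y r_y` of tensor tents. [folklore] -/
theorem energy_le [NeZero n] (hm : 3 ≤ m) {w : ℕ} (hw : 1 ≤ w) (hwn : w ≤ n) {μ : ℝ} (hμ : 0 ≤ μ) (B : Blk ν m → ℂ) :
    (star (superpose (rT n w) B) ⬝ᵥ (lapA ν m n μ *ᵥ superpose (rT n w) B)).re ≤ energyConst ν n w μ * nsq B := by
  rw [re_form_lapA]
  -- the mass term
  have h1 : nsq (superpose (rT n w) B) ≤ (3 : ℝ) ^ ν * ((n : ℝ) + 2 * w) ^ ν * nsq B := by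
    unfold nsq
    simp only [superpose_apply]
    refine sum_norm_sq_superpos_le (fun y x => rT n w y x) (fun y x => tentT n w y x) (fun y x => ?_) (by positivity)
      (fun x => sum_tentT_at_le w x) (fun y => sum_tentT_le hm hw y) B
    rw [rT, Complex.norm_real, Real.norm_of_nonneg (tentT_nonneg w y x)]
  -- the gradient terms
  have h2 : ∀ i, nsq (dMat i *ᵥ superpose (rT n w) B) ≤
      (6 / w * (3 : ℝ) ^ (ν - 1)) * (6 * n / w * ((n : ℝ) + 2 * w) ^ (ν - 1)) * nsq B := by
    intro i
    unfold nsq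
    simp only [dMat_superpose]
    refine sum_norm_sq_superpos_le (fun y x => ((dtentT n w i y x : ℝ) : ℂ)) (fun y x => |dtentT n w i y x|)
      (fun y x => by rw [Complex.norm_real, Real.norm_eq_abs]) (by positivity)
      (fun x => sum_abs_dtentT_at_le hm hw hwn i x) (fun y => sum_abs_dtentT_le hm hw hwn i y) B
  calc μ * nsq (superpose (rT n w) B) + ∑ i, nsq (dMat i *ᵥ superpose (rT n w) B)
      ≤ μ * ((3 : ℝ) ^ ν * ((n : ℝ) + 2 * w) ^ ν * nsq B) +
          ∑ _i : Fin ν, (6 / w * (3 : ℝ) ^ (ν - 1)) * (6 * n / w * ((n : ℝ) + 2 * w) ^ (ν - 1)) * nsq B :=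
        add_le_add (mul_le_mul_of_nonneg_left h1 hμ) (Finset.sum_le_sum fun i _ => h2 i)
    _ = energyConst ν n w μ * nsq B := by
        rw [Finset.sum_const, Finset.card_univ, Fintype.card_fin, nsmul_eq_mul, energyConst]; ring

/-- MODEL bookkeeping: the 1-D mass entry `(Σ_a tent y a · ind b a)/n`. [folklore] -/
def mass1 (n w : ℕ) (y b : ZMod m) : ℝ := (∑ a : ZMod m × Fin n, tent n w y a * ind n b a) / n

/-- `mass1 ≥ 0`. [folklore] -/
theorem mass1_nonneg (w : ℕ) (y b : ZMod m) : 0 ≤ mass1 (m := m) n w y b :=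
  div_nonneg (sum_tent_mul_ind_nonneg w y b) (Nat.cast_nonneg _)

/-- `mass1 y y = 1` (n ≥ 1). [folklore] -/
theorem mass1_self [NeZero n] (w : ℕ) (y : ZMod m) : mass1 (m := m) n w y y = 1 := by
  rw [mass1, sum_ind_self, div_self]
  exact Nat.cast_ne_zero.mpr (NeZero.ne n)

/-- Row sums of `mass1`: `Σ_b mass1 y b ≤ 1 + 2w/n`. [folklore] -/
theorem sum_mass1_row_le [NeZero n] (hm : 3 ≤ m) {w : ℕ} (hw : 1 ≤ w) (y : ZMod m) :
    ∑ b : ZMod m, mass1 (m := m) n w y b ≤ 1 + 2 * w / n := by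
  have hn : (0 : ℝ) < n := by exact_mod_cast Nat.pos_of_ne_zero (NeZero.ne n)
  rw [← Finset.add_sum_erase _ _ (Finset.mem_univ y), mass1_self]
  have h : ∑ b ∈ univ.erase y, mass1 (m := m) n w y b ≤ 2 * w / n := by
    unfold mass1
    rw [← Finset.sum_div]
    exact div_le_div_of_nonneg_right (rowSum_offdiag_le hm hw y) hn.le
  linarith

/-- Column sums of `mass1`: `Σ_y mass1 y b ≤ 1 + 2w/n`. [folklore] -/
theorem sum_mass1_col_le [NeZero n] (hm : 3 ≤ m) {w : ℕ} (hw : 1 ≤ w) (b : ZMod m) :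
    ∑ y : ZMod m, mass1 (m := m) n w y b ≤ 1 + 2 * w / n := by
  have hn : (0 : ℝ) < n := by exact_mod_cast Nat.pos_of_ne_zero (NeZero.ne n)
  rw [← Finset.add_sum_erase _ _ (Finset.mem_univ b), mass1_self]
  have h : ∑ y ∈ univ.erase b, mass1 (m := m) n w y b ≤ 2 * w / n := by
    unfold mass1
    rw [← Finset.sum_div]
    exact div_le_div_of_nonneg_right (colSum_offdiag_le hm hw b) hn.le
  linarith

/-- **The mass matrix entries are the products of the 1-D entries**: `(Qm r·(Qm q)ᴴ)(y,y′) = Π_i mass1 (y i) (y′ i)`.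
[folklore] -/
theorem mass_entry (w : ℕ) (y y' : Blk ν m) :
    massMatrix (rT (ν := ν) n w) (qT n) y y' = ((∏ i, mass1 (m := m) n w (y i) (y' i) : ℝ) : ℂ) := by
  have h1 : massMatrix (rT (ν := ν) n w) (qT n) y y' = ∑ x, ((tentT n w y x * meanT n y' x : ℝ) : ℂ) := by
    simp only [massMatrix, Matrix.mul_apply, Qm, Matrix.conjTranspose_apply, rT, qT, Complex.star_def,
      Complex.conj_ofReal, Complex.ofReal_mul]
  rw [h1, ← Complex.ofReal_sum]
  congr 1
  have h2 : ∀ x : Site ν m n, tentT n w y x * meanT n y' x = ∏ i, (tent n w (y i) (x i) * (ind n (y' i) (x i) / n)) :=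
    fun x => by rw [tentT, meanT, ← Finset.prod_mul_distrib]
  simp only [h2]
  rw [sum_prod_eq_prod_sum (fun i a => tent n w (y i) a * (ind n (y' i) a / n))]
  refine Finset.prod_congr rfl fun i _ => ?_
  rw [mass1, Finset.sum_div]
  exact Finset.sum_congr rfl fun a _ => by ring

/-- The product entries are ≥ 0. [folklore] -/
theorem prod_mass1_nonneg (w : ℕ) (y y' : Blk ν m) : 0 ≤ ∏ i, mass1 (m := m) n w (y i) (y' i) :=
  Finset.prod_nonneg fun _ _ => mass1_nonneg w _ _

/-- **Diagonal = 1.** [folklore] -/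
theorem mass_diag [NeZero n] (w : ℕ) (y : Blk ν m) : (massMatrix (rT (ν := ν) n w) (qT n) y y).re = 1 := by
  rw [mass_entry, Complex.ofReal_re]
  exact Finset.prod_eq_one fun i _ => mass1_self w (y i)

/-- MODEL bookkeeping: the off-diagonal mass bound σ = (1 + 2w/n)^ν − 1. [folklore] -/
def massSigma (ν n w : ℕ) : ℝ := (1 + 2 * (w : ℝ) / n) ^ ν - 1

/-- **Off-diagonal ROW sums ≤ (1 + 2w/n)^ν − 1.** [folklore] -/
theorem mass_row_le [NeZero n] (hm : 3 ≤ m) {w : ℕ} (hw : 1 ≤ w) (y : Blk ν m) :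
    ∑ y' ∈ univ.erase y, ‖massMatrix (rT (ν := ν) n w) (qT n) y y'‖ ≤ massSigma ν n w := by
  have hnorm : ∀ y' : Blk ν m, ‖massMatrix (rT (ν := ν) n w) (qT n) y y'‖ = ∏ i, mass1 (m := m) n w (y i) (y' i) :=
    fun y' => by rw [mass_entry, Complex.norm_real, Real.norm_of_nonneg (prod_mass1_nonneg w y y')]
  simp only [hnorm]
  rw [Finset.sum_erase_eq_sub (Finset.mem_univ y), Finset.prod_eq_one (fun i _ => mass1_self w (y i)),
    sum_prod_eq_prod_sum (fun i b => mass1 n w (y i) b), massSigma]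
  refine sub_le_sub_right ?_ 1
  calc ∏ i, ∑ b : ZMod m, mass1 n w (y i) b ≤ ∏ _i : Fin ν, (1 + 2 * (w : ℝ) / n) :=
        Finset.prod_le_prod (fun i _ => Finset.sum_nonneg fun b _ => mass1_nonneg w _ _)
          fun i _ => sum_mass1_row_le hm hw (y i)
    _ = (1 + 2 * (w : ℝ) / n) ^ ν := by rw [Finset.prod_const, Finset.card_univ, Fintype.card_fin]

/-- **Off-diagonal COLUMN sums ≤ (1 + 2w/n)^ν − 1.** [folklore] -/
theorem mass_col_le [NeZero n] (hm : 3 ≤ m) {w : ℕ} (hw : 1 ≤ w) (y' : Blk ν m) :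
    ∑ y ∈ univ.erase y', ‖massMatrix (rT (ν := ν) n w) (qT n) y y'‖ ≤ massSigma ν n w := by
  have hnorm : ∀ y : Blk ν m, ‖massMatrix (rT (ν := ν) n w) (qT n) y y'‖ = ∏ i, mass1 (m := m) n w (y i) (y' i) :=
    fun y => by rw [mass_entry, Complex.norm_real, Real.norm_of_nonneg (prod_mass1_nonneg w y y')]
  simp only [hnorm]
  rw [Finset.sum_erase_eq_sub (Finset.mem_univ y'), Finset.prod_eq_one (fun i _ => mass1_self w (y' i)),
    sum_prod_eq_prod_sum (fun i b => mass1 n w b (y' i)), massSigma]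
  refine sub_le_sub_right ?_ 1
  calc ∏ i, ∑ b : ZMod m, mass1 n w b (y' i) ≤ ∏ _i : Fin ν, (1 + 2 * (w : ℝ) / n) :=
        Finset.prod_le_prod (fun i _ => Finset.sum_nonneg fun b _ => mass1_nonneg w _ _)
          fun i _ => sum_mass1_col_le hm hw (y' i)
    _ = (1 + 2 * (w : ℝ) / n) ^ ν := by rw [Finset.prod_const, Finset.card_univ, Fintype.card_fin]

/-- **MASS COERCIVITY**: `(1 − σ)‖B‖² ≤ Re (SB)*(Q̃ᵀ-pairing)`, σ = (1 + 2w/n)^ν − 1 (two-sided Gershgorin). [folklore] -/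
theorem mass_coercive [NeZero n] (hm : 3 ≤ m) {w : ℕ} (hw : 1 ≤ w) (B : Blk ν m → ℂ) :
    (1 - massSigma ν n w) * nsq B ≤ (star (superpose (rT n w) B) ⬝ᵥ superpose (qT n) B).re := by
  rw [star_superpose_dotProduct_eq]
  have h := re_form_ge_of_rowcol (massMatrix (rT (ν := ν) n w) (qT n)) (δ := 1) (σr := massSigma ν n w)
    (σc := massSigma ν n w) (fun y => (mass_diag w y).symm.le) (fun y => mass_row_le hm hw y)
    (fun y' => mass_col_le hm hw y') B
  have e : (1 : ℝ) - (massSigma ν n w + massSigma ν n w) / 2 = 1 - massSigma ν n w := by ring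
  rwa [e] at h

/-! ## §4  END: coercivity of the coarse operator Q̃A⁻¹Q̃ᵀ, uniformly in the block size after scaling -/

/-- **E-I3 AT U = 1 (MODEL): THE COARSE OPERATOR OF THE FREE MASSIVE LAPLACIAN IS COERCIVE WITH AN EXPLICIT CONSTANT.**
On the torus (ℤ/m × Fin n)^ν (m ≥ 3 blocks of side n per axis), A = μ·1 + Σ_i D_iᴴD_i (μ > 0), Q̃ = block means,
tents of ramp width w (1 ≤ w, w ≤ n) with `(1 + 2w/n)^ν < 2`: for every B,
`(c²/E)·‖B‖² ≤ Re B*(Q̃A⁻¹Q̃ᵀ)B` with c = 2 − (1 + 2w/n)^ν and E = `energyConst ν n w μ` — an4's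
`sandwich_coercive_of_quasiReconstruction` BY NAME on the tensor tents.  At μ = a/n², w ≍ n/ν: c ≥ const, E ≍ n^{ν−2}, i.e.
Q̃A⁻¹Q̃ᵀ ≳ n^{2−ν}·γ₀(ν, a) — B6 (2.76)'s absolute γ₀ in lattice units, no Fourier analysis. [folklore] -/
theorem coarse_coercive_tent_torus [NeZero n] (hm : 3 ≤ m) {w : ℕ} (hw : 1 ≤ w) (hwn : w ≤ n) {μ : ℝ} (hμ : 0 < μ)
    (hσ : (1 + 2 * (w : ℝ) / n) ^ ν < 2) (B : Blk ν m → ℂ) :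
    (2 - (1 + 2 * (w : ℝ) / n) ^ ν) ^ 2 / energyConst ν n w μ * nsq B ≤
      (star B ⬝ᵥ (sandwich (lapA ν m n μ) (qT n) *ᵥ B)).re := by
  have hn : (0 : ℝ) < n := by exact_mod_cast Nat.pos_of_ne_zero (NeZero.ne n)
  have hc : 0 < 2 - (1 + 2 * (w : ℝ) / n) ^ ν := by linarith
  have hE : 0 < energyConst ν n w μ := by
    unfold energyConst
    have : (0 : ℝ) < μ * 3 ^ ν * ((n : ℝ) + 2 * w) ^ ν := by positivity
    have : (0 : ℝ) ≤ ν * (6 / w * (3 : ℝ) ^ (ν - 1)) * (6 * n / w * ((n : ℝ) + 2 * w) ^ (ν - 1)) := by positivity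
    linarith
  have hmass : ∀ B' : Blk ν m → ℂ, (2 - (1 + 2 * (w : ℝ) / n) ^ ν) * nsq B' ≤
      (star (superpose (rT n w) B') ⬝ᵥ superpose (qT n) B').re := fun B' => by
    have h := mass_coercive (ν := ν) (n := n) hm hw B'
    have e : (1 : ℝ) - massSigma ν n w = 2 - (1 + 2 * (w : ℝ) / n) ^ ν := by rw [massSigma]; ring
    rwa [e] at h
  exact sandwich_coercive_of_quasiReconstruction (lapA ν m n μ) (lapA_isHermitian μ) (lapA_isUnit hμ)
    (lapA_re_nonneg hμ.le) (qT n) (rT n w) hc hE hmass (fun B' => energy_le hm hw hwn hμ.le B') B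

end

end Summit.QuantumFields.BalabanUV.Beta.TentQuasiReconstructionTorus
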